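import Literature.Computability.AlgebraicComplexity.BideterminantReductionProofs

/-!
# Andrews–Forbes 2022, Proposition 3.5 over every infinite field; Theorem 3.8 in characteristic `p`

The tree's `AndrewsForbes2022_prop_3_5_holds` (`BideterminantReductionProofs.lean`, the reduction of
a nonzero `f ∈ I^det_{n,m,r}` to a single standard bideterminant `ε^q α (K_σ|K_σ) + O(ε^{q+1})`) is
stated under `[CharZero F]`, but its proof uses characteristic zero ONLY through `Infinite F` (the
evaluation / vanishing-ideal lemmas `coeff_twist_mem_vanishIdeal`, `ev_lower_upper_init_eq`,
`init_mem_vanishIdeal`, … are stated for `[Infinite F]`; the one `[CharZero F]` binder sits on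
`init_eq_C_mul_prod`).  This file re-runs that identification step and the final assembly VERBATIM
with `[Infinite F]` (`AndrewsForbes.init_eq_C_mul_prod_of_infinite`,
`AndrewsForbes2022_prop_3_5_of_infinite` — every infinite field, every characteristic, and without the
unused bound `r ≤ min(n,m)`).  Combined with the char-`p` skeleton `AndrewsForbes2022_thm_3_8_posChar_at`
(`AndrewsForbes2022PosCharReductions.lean`) it gives **Theorem 3.8's positive-characteristic bullet over
every INFINITE field of characteristic `p`** (e.g. algebraically closed fields) — a twelve-line corollary
kept in the sibling `AndrewsForbes2022Thm38PosCharInfinite.lean` so that this file depends only on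
`BideterminantReductionProofs`.  The typed fact
`AndrewsForbes2022_thm_3_8_posChar` (all fields of char `p`, finite ones included) remains open: for a
finite field the evaluation arguments need a base change to an infinite extension and a descent of the
`𝔽(ε)`-linear change of variables, not done here.  No new named facts; net debt `0`.

Honest framing: generalisation of a proved reduction between typed literature statements;
VP ≠ VNP is NOT proved.

## References
* [AndrewsForbes2022] R. Andrews, M. A. Forbes, STOC 2022, arXiv:2112.00792 — Prop. 3.5 (p0021:L41,
  no characteristic hypothesis in print), Thm. 3.8 third bullet (p0023:L57, proof p0024:L40–L45).
-/

noncomputable section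

namespace Literature.Computability.AlgebraicComplexity

namespace AndrewsForbes

open MvPolynomial Matrix

variable {F : Type*} [Field F] {n m : ℕ}

section IdentificationInfinite

variable {b q : ℕ} {f : MvPolynomial (Fin n × Fin m) F}
  {A : Matrix (Fin n) (Fin n) F} {B : Matrix (Fin m) (Fin m) F}

/-- **Identification of the initial form** (the replacement for the straightening-law bookkeeping
of Lemma 3.4 / Prop. 3.5): the initial form `h` equals `c · ∏_k (det X_{[k+1],[k+1]})^{μ_k - μ_{k+1}}`
with `c = h(diag(1,…,1)) ≠ 0` and `μ` the (non-increasing, eventually zero) row weight of `e₀`.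
Variant of `init_eq_C_mul_prod` for every INFINITE field (same proof; `[CharZero F]` was used only
through `Infinite F`). [cite: AndrewsForbes2022, Prop. 3.5 (with Lemma 3.4)] -/
theorem init_eq_C_mul_prod_of_infinite [Infinite F] (hb : 2 ≤ b) (hbf : f.totalDegree + 2 ≤ b)
    (hmin : ∀ (A' : Matrix (Fin n) (Fin n) F) (B' : Matrix (Fin m) (Fin m) F),
      IsUnit A'.det → IsUnit B'.det →
      ∀ e ∈ (transl A' B' f).support, q ≤ Finsupp.weight (dwt n m b) e)
    (hA : IsUnit A.det) (hB : IsUnit B.det) {e₀ : Fin n × Fin m →₀ ℕ}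
    (he₀ : e₀ ∈ (transl A B f).support) (hw₀ : Finsupp.weight (dwt n m b) e₀ = q) :
    ∃ c : F, c ≠ 0 ∧ (∀ i, min n m ≤ i → rowWt' e₀ i = 0) ∧ (∀ i, rowWt' e₀ (i + 1) ≤ rowWt' e₀ i) ∧
      (twist (dwt n m b) (transl A B f)).coeff q =
        C c * ∏ k ∈ Finset.range (min n m),
          leadingMinor F n m (k + 1) ^ (rowWt' e₀ k - rowWt' e₀ (k + 1)) := by
  classical
  set h := (twist (dwt n m b) (transl A B f)).coeff q with hhdef
  have hh0 : h ≠ 0 := init_ne_zero he₀ hw₀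
  have hrow : ∀ e ∈ h.support, rowWt e = rowWt e₀ := fun e he =>
    (rowWt_eq_of_mem_support_init hbf he₀ hw₀ he).1
  have hinvF := ev_lower_upper_init_eq hb hmin hA hB (f := f) (q := q)
  have hanti : ∀ i i' : Fin n, i < i' → rowWt e₀ i' ≤ rowWt e₀ i := fun i i' hii' =>
    rowWt_antitone hb hmin hA hB he₀ hw₀ hii'
  -- the numerical diagonal test matrix and `c`
  let D1F : Matrix (Fin n) (Fin m) F := Matrix.of fun i j => if (i : ℕ) = (j : ℕ) then 1 else 0
  set c : F := ev D1F h with hcdef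
  -- the big fraction field
  set s := n + m with hsdef
  have hn : n ≤ s := Nat.le_add_right n m
  have hm : m ≤ s := Nat.le_add_left m n
  let Rb := MvPolynomial (Fin s × Fin s) F
  let 𝕂 := FractionRing Rb
  have hinjR : Function.Injective (algebraMap Rb 𝕂) := IsFractionRing.injective Rb 𝕂
  let Zh : Matrix (Fin s) (Fin s) 𝕂 := (mvPolynomialX (Fin s) (Fin s) F).map (algebraMap Rb 𝕂)
  have hZ : ∀ k (hk : k ≤ s), (Zh.submatrix (Fin.castLE hk) (Fin.castLE hk)).det ≠ 0 := by
    intro k hk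
    rw [Matrix.submatrix_map, ← RingHom.mapMatrix_apply, ← RingHom.map_det,
      map_ne_zero_iff _ hinjR]
    exact det_corner_mvPolynomialX_ne_zero hk
  obtain ⟨Lh, Uh, δ, hLt, hLd, hUt, hUd, hLZU⟩ := exists_lower_mul_mul_upper_eq_diagonal s Zh hZ
  let L : Matrix (Fin n) (Fin n) 𝕂 := Lh.submatrix (Fin.castLE hn) (Fin.castLE hn)
  let U : Matrix (Fin m) (Fin m) 𝕂 := Uh.submatrix (Fin.castLE hm) (Fin.castLE hm)
  have hL' : L.BlockTriangular OrderDual.toDual := fun i j hij =>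
    hLt (show OrderDual.toDual (Fin.castLE hn j) < OrderDual.toDual (Fin.castLE hn i) from
      OrderDual.toDual_lt_toDual.mpr
        (Fin.lt_def.mpr (Fin.lt_def.mp (OrderDual.toDual_lt_toDual.mp hij))))
  have hLd' : ∀ i, L i i = 1 := fun i => hLd _
  have hU' : U.BlockTriangular id := fun i j hij =>
    hUt (show id (Fin.castLE hm j) < id (Fin.castLE hm i) from Fin.lt_def.mpr (Fin.lt_def.mp hij))
  have hUd' : ∀ i, U i i = 1 := fun i => hUd _
  -- the generic `n × m` corner and the evaluation at it (an injection `𝔽[X] → 𝕂`)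
  let Xm : Matrix (Fin n) (Fin m) 𝕂 := Zh.submatrix (Fin.castLE hn) (Fin.castLE hm)
  let emb : Fin n × Fin m → Fin s × Fin s := fun ij => (Fin.castLE hn ij.1, Fin.castLE hm ij.2)
  have hemb : Function.Injective emb := by
    intro x y hxy
    simp only [emb, Prod.mk.injEq] at hxy
    exact Prod.ext (Fin.castLE_injective hn hxy.1) (Fin.castLE_injective hm hxy.2)
  have hevXm : (ev Xm : MvPolynomial (Fin n × Fin m) F →ₐ[F] 𝕂) =
      (IsScalarTower.toAlgHom F Rb 𝕂).comp (rename emb) := by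
    refine MvPolynomial.algHom_ext fun ij => ?_
    rw [ev_X, AlgHom.comp_apply, rename_X, IsScalarTower.coe_toAlgHom']
    simp [Xm, Zh, emb]
  have hinj : Function.Injective (ev Xm : MvPolynomial (Fin n × Fin m) F →ₐ[F] 𝕂) := by
    rw [hevXm, AlgHom.coe_comp]
    exact hinjR.comp (rename_injective emb hemb)
  -- Gauss: `L · Xm · U` is the corner of a diagonal matrix
  have hcorner : L * Xm * U = (diagonal δ).submatrix (Fin.castLE hn) (Fin.castLE hm) := by
    rw [← hLZU]
    exact (submatrix_mul_mul_castLE Lh Zh Uh hLt hUt hn hm).symm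
  let a : Fin n → 𝕂 := fun i => δ (Fin.castLE hn i)
  let D1 : Matrix (Fin n) (Fin m) 𝕂 := Matrix.of fun i j => if (i : ℕ) = (j : ℕ) then 1 else 0
  have hD : (diagonal δ).submatrix (Fin.castLE hn) (Fin.castLE hm) =
      Matrix.of fun i j => a i * D1 i j := by
    rw [corner_diagonal]
    ext i j
    simp only [Matrix.of_apply, D1, a, mul_ite, mul_one, mul_zero]
  -- invariance transported to `𝕂`, then scaling
  have hinvK : ev (L * Xm * U) h = ev Xm h :=
    ev_lower_mul_mul_upper_eq_of_forall h hinvF L U hL' hLd' hU' hUd' Xm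
  have hD1 : ev D1 h = algebraMap F 𝕂 c := by
    have hmat : D1F.map (Algebra.ofId F 𝕂) = D1 := by
      ext i j
      simp only [D1, D1F, Matrix.map_apply, Matrix.of_apply, apply_ite (Algebra.ofId F 𝕂), map_one,
        map_zero]
    rw [hcdef, show algebraMap F 𝕂 (ev D1F h) = (Algebra.ofId F 𝕂) (ev D1F h) from rfl, map_ev, hmat]
  have hE1 : ev Xm h = (∏ i, a i ^ rowWt e₀ i) * algebraMap F 𝕂 c := by
    rw [← hinvK, hcorner, hD, ev_rowScale_of_rowWt_eq a D1 h (rowWt e₀) hrow, hD1]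
  -- `c ≠ 0`
  have hc : c ≠ 0 := by
    intro hc0
    apply hh0
    apply hinj
    rw [hE1, hc0, map_zero, mul_zero, map_zero]
  -- rows `≥ m` carry no weight
  have hvan : ∀ i : Fin n, m ≤ (i : ℕ) → rowWt e₀ i = 0 := by
    intro i hi
    let a' : Fin n → F := fun i => if (i : ℕ) < m then 1 else 0
    have hsc := ev_rowScale_of_rowWt_eq a' D1F h (rowWt e₀) hrow
    have hmat : (Matrix.of fun i j => a' i * D1F i j) = D1F := by
      ext i' j
      simp only [Matrix.of_apply, a', D1F]
      by_cases h1 : (i' : ℕ) < m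
      · simp [h1]
      · have : ¬ ((i' : ℕ) = (j : ℕ)) := fun h2 => h1 (h2 ▸ j.2)
        simp [h1, this]
    rw [hmat, ← hcdef] at hsc
    have hprod : ∏ i', a' i' ^ rowWt e₀ i' = 1 :=
      mul_right_cancel₀ hc (hsc.symm.trans (one_mul c).symm)
    by_contra hμ
    have hzero : a' i ^ rowWt e₀ i = 0 := by
      simp only [a', if_neg (not_lt.mpr hi)]
      exact zero_pow hμ
    have := Finset.prod_eq_zero (f := fun i' => a' i' ^ rowWt e₀ i') (Finset.mem_univ i) hzero
    rw [hprod] at this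
    exact one_ne_zero this
  -- leading principal minors in `𝕂`
  have hminor : ∀ k (hkn : k ≤ n) (hkm : k ≤ m),
      ev Xm (leadingMinor F n m k) = ∏ i : Fin k, δ (Fin.castLE (hkn.trans hn) i) := by
    intro k hkn hkm
    rw [leadingMinor_of_le hkn hkm, ev_det_submatrix]
    have h1 := submatrix_mul_mul_castLE L Xm U hL' hU' hkn hkm
    have h2 : ((L * Xm * U).submatrix (Fin.castLE hkn) (Fin.castLE hkm)).det =
        (Xm.submatrix (Fin.castLE hkn) (Fin.castLE hkm)).det := by
      rw [h1, det_mul, det_mul, det_corner_eq_one_of_lower L hL' hLd' hkn,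
        det_corner_eq_one_of_upper U hU' hUd' hkm, one_mul, mul_one]
    rw [← h2, hcorner, submatrix_submatrix]
    have e1 : (Fin.castLE hn ∘ Fin.castLE hkn : Fin k → Fin s) = Fin.castLE (hkn.trans hn) :=
      funext fun i => Fin.ext rfl
    have e2 : (Fin.castLE hm ∘ Fin.castLE hkm : Fin k → Fin s) = Fin.castLE (hkn.trans hn) :=
      funext fun i => Fin.ext rfl
    rw [e1, e2, det_corner_diagonal]
  -- bookkeeping with natural indices
  let μ' : ℕ → ℕ := rowWt' e₀
  have hμ'anti : ∀ i, μ' (i + 1) ≤ μ' i := by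
    intro i
    by_cases hi1 : i + 1 < n
    · simp only [μ', rowWt'_of_lt e₀ hi1, rowWt'_of_lt e₀ (Nat.lt_of_succ_lt hi1)]
      exact hanti ⟨i, _⟩ ⟨i + 1, hi1⟩ (Fin.lt_def.mpr (Nat.lt_succ_self i))
    · simp only [μ', rowWt'_of_le e₀ (not_lt.mp hi1)]
      exact Nat.zero_le _
  have hμ'0 : ∀ i, min n m ≤ i → μ' i = 0 := by
    intro i hi
    by_cases hin : i < n
    · simp only [μ', rowWt'_of_lt e₀ hin]
      exact hvan ⟨i, hin⟩ (by simp only; omega)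
    · exact rowWt'_of_le e₀ (not_lt.mp hin)
  let A' : ℕ → 𝕂 := fun i => if h : i < s then δ ⟨i, h⟩ else 1
  have hA'fin : ∀ k (hk : k ≤ s), ∏ i : Fin k, δ (Fin.castLE hk i) = ∏ i ∈ Finset.range k, A' i := by
    intro k hk
    rw [← Fin.prod_univ_eq_prod_range]
    refine Finset.prod_congr rfl fun i _ => ?_
    have hi : (i : ℕ) < s := lt_of_lt_of_le i.2 hk
    simp only [A', dif_pos hi]
    rfl
  set p := min n m with hpdef
  have hpn : p ≤ n := Nat.min_le_left n m
  have hpm : p ≤ m := Nat.min_le_right n m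
  -- `ev Xm h = c · ∏_{i<p} A'_i^{μ'_i}`
  have hE2 : ev Xm h = algebraMap F 𝕂 c * ∏ i ∈ Finset.range p, A' i ^ μ' i := by
    rw [hE1, mul_comm]
    congr 1
    have h1 : ∏ i : Fin n, a i ^ rowWt e₀ i = ∏ i ∈ Finset.range n, A' i ^ μ' i := by
      rw [← Fin.prod_univ_eq_prod_range]
      refine Finset.prod_congr rfl fun i _ => ?_
      have hi : (i : ℕ) < s := lt_of_lt_of_le i.2 hn
      simp only [a, A', μ', dif_pos hi, rowWt'_of_lt e₀ i.2]
      rfl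
    rw [h1]
    symm
    refine Finset.prod_subset (Finset.range_subset_range.mpr hpn) fun i _ hip => ?_
    rw [hμ'0 i (not_lt.mp (by simpa using hip)), pow_zero]
  -- `ev Xm (∏ minors) = ∏_{i<p} A'_i^{μ'_i}`
  have hE3 : ev Xm (∏ k ∈ Finset.range p, leadingMinor F n m (k + 1) ^ (μ' k - μ' (k + 1))) =
      ∏ i ∈ Finset.range p, A' i ^ μ' i := by
    rw [map_prod]
    have h1 : ∀ k ∈ Finset.range p, ev Xm (leadingMinor F n m (k + 1) ^ (μ' k - μ' (k + 1))) =
        (∏ i ∈ Finset.range (k + 1), A' i) ^ (μ' k - μ' (k + 1)) := by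
      intro k hk
      have hk' : k + 1 ≤ p := Finset.mem_range.mp hk
      rw [map_pow, hminor (k + 1) (hk'.trans hpn) (hk'.trans hpm), hA'fin (k + 1) ((hk'.trans hpn).trans hn)]
    rw [Finset.prod_congr rfl h1, prod_pow_sub_telescope A' μ' hμ'anti p]
    refine Finset.prod_congr rfl fun i _ => ?_
    rw [hμ'0 p le_rfl, Nat.sub_zero]
  refine ⟨c, hc, hμ'0, hμ'anti, hinj ?_⟩
  rw [map_mul, ev_C, hE3, ← hE2]

end IdentificationInfinite

end AndrewsForbes

open MvPolynomial Matrix AndrewsForbes in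
/-- **Proposition 3.5 over every infinite field** (all characteristics): the conclusion of
`AndrewsForbes2022_prop_3_5` with `[CharZero F]` replaced by `[Infinite F]` — the tree's proof
(`AndrewsForbes2022_prop_3_5_holds`) verbatim over `init_eq_C_mul_prod_of_infinite`.
[cite: AndrewsForbes2022, Prop. 3.5] -/
theorem AndrewsForbes2022_prop_3_5_of_infinite (F : Type) [Field F] [Infinite F] (n m r : ℕ)
    (hr : 0 < r) (f : MvPolynomial (Fin n × Fin m) F)
    (hf : f ∈ detIdeal F n m r) (hf0 : f ≠ 0) :
    ∃ (c : Matrix (Fin n × Fin m) (Fin n × Fin m) (RatFunc F)) (q : ℤ) (α : F) (σ : Multiset ℕ),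
      IsUnit c ∧ α ≠ 0 ∧ r ≤ σ.sup ∧ (∀ s ∈ σ, 0 < s ∧ s ≤ min n m) ∧
      ∀ e : (Fin n × Fin m) →₀ ℕ,
        IsBigOEps F (q + 1) (MvPolynomial.coeff e
          (MvPolynomial.aeval
              (fun ij : Fin n × Fin m =>
                ∑ kl : Fin n × Fin m, MvPolynomial.C (c ij kl) * MvPolynomial.X kl) f -
            MvPolynomial.C (RatFunc.X ^ q * algebraMap F (RatFunc F) α) *
              MvPolynomial.map (algebraMap F (RatFunc F)) (kBideterminant F n m σ))) := by
  classical
  obtain ⟨q, A, B, e₀, hA, hB, he₀, hw₀, hmin⟩ := exists_min_weight (f.totalDegree + 2) hf0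
  obtain ⟨c, hc, hμ0, hμanti, hh⟩ :=
    init_eq_C_mul_prod_of_infinite (b := f.totalDegree + 2) (by omega) le_rfl hmin hA hB he₀ hw₀
  have hpn : min n m ≤ n := Nat.min_le_left n m
  have hpm : min n m ≤ m := Nat.min_le_right n m
  have hK : kBideterminant F n m (∑ k ∈ Finset.range (min n m),
      Multiset.replicate (rowWt' e₀ k - rowWt' e₀ (k + 1)) (k + 1)) =
      ∏ k ∈ Finset.range (min n m), leadingMinor F n m (k + 1) ^ (rowWt' e₀ k - rowWt' e₀ (k + 1)) :=
    kBideterminant_sum_replicate (fun k => rowWt' e₀ k - rowWt' e₀ (k + 1)) (min n m)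
  -- the change of variables `x_{ij} ↦ ∑_{kl} A_{ik} B_{lj} ε^{w(k,l)} x_{kl}` is invertible
  have hunit : IsUnit (Matrix.of fun (ij kl : Fin n × Fin m) =>
      algebraMap F (RatFunc F) (A ij.1 kl.1 * B kl.2 ij.2) *
        (RatFunc.X : RatFunc F) ^ dwt n m (f.totalDegree + 2) kl) := by
    have hcM : (Matrix.of fun (ij kl : Fin n × Fin m) =>
        algebraMap F (RatFunc F) (A ij.1 kl.1 * B kl.2 ij.2) *
          (RatFunc.X : RatFunc F) ^ dwt n m (f.totalDegree + 2) kl) =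
        Matrix.kroneckerMap (· * ·) (A.map (algebraMap F (RatFunc F)))
            ((B.transpose).map (algebraMap F (RatFunc F))) *
          diagonal fun kl : Fin n × Fin m => (RatFunc.X : RatFunc F) ^ dwt n m (f.totalDegree + 2) kl := by
      ext ⟨i, j⟩ ⟨k, l⟩
      simp [Matrix.mul_diagonal, Matrix.kroneckerMap_apply, map_mul]
    rw [hcM]
    refine IsUnit.mul ?_ ?_
    · rw [Matrix.isUnit_iff_isUnit_det, Matrix.det_kronecker, isUnit_iff_ne_zero]
      refine mul_ne_zero (pow_ne_zero _ ?_) (pow_ne_zero _ ?_)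
      · rw [← RingHom.mapMatrix_apply, ← RingHom.map_det, map_ne_zero]
        exact hA.ne_zero
      · rw [← RingHom.mapMatrix_apply, ← RingHom.map_det, det_transpose, map_ne_zero]
        exact hB.ne_zero
    · rw [Matrix.isUnit_diagonal]
      exact Pi.isUnit_iff.mpr fun kl => isUnit_iff_ne_zero.mpr (pow_ne_zero _ RatFunc.X_ne_zero)
  refine ⟨_, (q : ℤ), c, ∑ k ∈ Finset.range (min n m),
    Multiset.replicate (rowWt' e₀ k - rowWt' e₀ (k + 1)) (k + 1), hunit, hc, ?_, ?_, ?_⟩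
  · -- `σ₁ ≥ r`: the initial form vanishes at the rank-`(r-1)` test matrix
    have hv : ev (rectOne F n m (r - 1)) (C c * ∏ k ∈ Finset.range (min n m),
        leadingMinor F n m (k + 1) ^ (rowWt' e₀ k - rowWt' e₀ (k + 1))) = 0 := by
      rw [← hh]
      have hmem := init_mem_vanishIdeal (A := A) (B := B) (b := f.totalDegree + 2) (q := q)
        (Nat.sub_lt hr Nat.one_pos) hf
      have := (mem_vanishIdeal_iff.mp hmem) 1 1
      rwa [Matrix.one_mul, Matrix.mul_one] at this
    obtain ⟨k, hkp, hrk, hk0⟩ := exists_part_ge hr hpn hpm hc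
      (fun k => rowWt' e₀ k - rowWt' e₀ (k + 1)) hv
    have hmemσ : k + 1 ∈ ∑ k ∈ Finset.range (min n m),
        Multiset.replicate (rowWt' e₀ k - rowWt' e₀ (k + 1)) (k + 1) :=
      Multiset.mem_sum.mpr ⟨k, Finset.mem_range.mpr hkp, Multiset.mem_replicate.mpr ⟨hk0, rfl⟩⟩
    exact hrk.trans (Multiset.le_sup hmemσ)
  · -- all parts lie in `[1, min n m]`
    intro s' hs'
    obtain ⟨k, hk, hks⟩ := Multiset.mem_sum.mp hs'
    obtain ⟨_, rfl⟩ := Multiset.mem_replicate.mp hks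
    exact ⟨Nat.succ_pos k, Finset.mem_range.mp hk⟩
  · -- the `ε`-expansion, coefficient by coefficient
    intro e
    simp only [Matrix.of_apply]
    rw [aeval_sum_eq_ev_transl, coeff_sub, coeff_ev_weightSubst, coeff_C_mul, coeff_map, hK,
      zpow_natCast]
    have hhe := congrArg (coeff e) hh
    rw [coeff_C_mul, coeff_coeff_twist] at hhe
    by_cases hwe : Finsupp.weight (dwt n m (f.totalDegree + 2)) e = q
    · -- the leading coefficient: exact cancellation
      rw [if_pos hwe] at hhe
      rw [hhe, hwe, map_mul]
      convert isBigOEps_zero (F := F) ((q : ℤ) + 1) using 2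
      ring
    · -- all other coefficients are `O(ε^{q+1})`
      rw [if_neg hwe] at hhe
      have hPi : coeff e (∏ k ∈ Finset.range (min n m),
          leadingMinor F n m (k + 1) ^ (rowWt' e₀ k - rowWt' e₀ (k + 1))) = 0 := by
        rcases mul_eq_zero.mp hhe.symm with h | h
        · exact absurd h hc
        · exact h
      rw [hPi, map_zero, mul_zero, sub_zero]
      by_cases hsupp : e ∈ (transl A B f).support
      · have hq := hmin A B hA hB e hsupp
        have hlt : q < Finsupp.weight (dwt n m (f.totalDegree + 2)) e := lt_of_le_of_ne hq (Ne.symm hwe)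
        exact isBigOEps_algebraMap_mul_X_pow _ (by exact_mod_cast hlt)
      · rw [MvPolynomial.notMem_support_iff.mp hsupp, map_zero, zero_mul]
        exact isBigOEps_zero _


end Literature.Computability.AlgebraicComplexity
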